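/-
Origin: expansion seat `prover-pub-hodgecm-mc-binder-2-g14-0`, handover #S2 2026-08-20T12:17Z md5 e9295e144b42 (PKG 29709fc15ee8 → e9295e144b42; 158 l.; σ implicit; statements over `datumAtσ … σ`; proofs verbatim) (`HOME/mc/pub-hodgecm-mc-binder-2/g14/s5b/HodgeCM/Model/HypCensus/OmgInsPinChoice.lean`, md5 e9295e144b42, 158 lines);
landed by the gen-20 packager (p-g20) in gate run 51 REPLACES the earlier landed copy of `HodgeCM/Model/HypCensus/OmgInsPinChoice.lean` (seat copy carried the packager Origin header of an earlier run (stripped)).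
-/
/-
Origin: speedrun cell pub-hodgecm, MODEL-CONSTRUCTION sub-cell, lineage mc-binder-2 (BINDER-OWNERS rows 18/19: E binders
`hyp12` / `hyp34` of `Model.perL_picardCM_r15A`), seat prover-pub-hodgecm-mc-binder-2-g11-0 (gen 11), 2026-08-20.
Target in PKG: `HodgeCM/Model/HypCensus/OmgInsPinChoice.lean` (NEW additive leaf; imports this lineage's `HypCensus/OmgInsPin`,
`HypCensus/OmgInsIotaChoice` (gen 11) and `HypCensus/PlaceChoice` (#29, RUN 38)).
KERNEL ONLY: 0 records, nothing cited as hypothesis, 0 `def … : Prop`; one data def + theorems.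
-/
import Summits.HodgeConjecture.HodgeCM.Model.HypCensus.OmgInsPin
import Summits.HodgeConjecture.HodgeCM.Model.HypCensus.OmgInsIotaChoice
import Summits.HodgeConjecture.HodgeCM.Model.HypCensus.PlaceChoice

/-!
# Census kit (rows A12/A34): `omg_ins` AT THE PRINTED VACUUM for the CHOSEN place data `datumAt`, from ONE scalar identity

With the place data of E's pin CHOSEN from the sign facts (`PlaceChoice.datumAt V S jD jI`, #29) and the `ι₁` identification CHOSEN by
`OmgInsIotaChoice.jIAt`, every per-place input of `OmgInsPin.omgW_ins_vacuum_eq_of_weight` is discharged: the only remaining hypothesis of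
the census field `omg_ins` at `φ₀` (rows 18/19, junction (J-T12)) is THE SCALAR IDENTITY ON THE TORUS

  `hμ : ∀ t, η(archProdHom (1, archDiag (dW S) u_t)) · χ_T(u_t) · dIotaAt(u_t) = (printPlacesW t)⁻¹`,  `u_t = placesEquiv⁻¹ (placesCoord t)`

— the (J-μ)/(R3) consistency of the context's `(η, μ)` with the pin's torus character (glue-1's S-side read-off).

* `jIOf V S hW` — the `ι₁` identification family fed to `datumAt`; `dAt` — the per-place scalar (`dIotaAt` at the place under `ι₁`, `1` elsewhere);
* `datumAt_kind_ne_iota_of_ne` / `eq_cmPlace_of_datumAt_kind` — the kind of `datumAt` is `ι₁` exactly at the place under `ι₁`;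
* **`omgW_ins_vacuum_datumAt_eq_of_weight`** / **`omgW_ins_smul_vacuum_datumAt_eq_of_weight`** — `ω(ι_T t)(ins f (a • φ₀)) = ins f (ω_T t (a • φ₀))`
  at the W pin of record `wmInputCM₂g` for the chosen data, from `hμ` alone (plus the sign fact `hW`).

Nothing here is a claim of PerL/QW8.  Style lint (L-notation): no `local notation`.
-/

set_option autoImplicit false

noncomputable section

open Filter Topology
open NumberField NumberField.InfinitePlace
open scoped TensorProduct Classical
open MvPolynomial
open Literature.NumberTheory.Automorphic Literature.NumberTheory.Automorphic.UnitaryGroup Literature.NumberTheory.Weil1964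
open Literature.RepresentationTheory.KonnoKonno2007 Literature.RepresentationTheory.KonnoKonno2007.RealDualPair
open Literature.NumberTheory.GelbartRogawski1991 Literature.NumberTheory.GelbartRogawski1991.UnitaryDualPair
open Literature.Analysis.SegalBargmann
open HodgeCM HodgeCM.Model HodgeCM.Adelic
open HodgeCM.PerL34.Fock HodgeCM.PerL34.Fock.PrintDict
open NumberField.SeesawArchTorus

namespace HodgeCM.Model.HypCensus

section PinChoice

variable {L : CMField} {ι₁ : L →+* ℂ} (V : HermSpace3 L ι₁) (S : StubTree.SeesawDatum L)
variable
  (hGR : (cmSplittingDatum (L : Type) finProdFinEquiv (frameD V) (frameD_real V) (frameD_ne V) (dW S) (dW_real S) (dW_ne S)).CompatibleSplitting)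
  (η : CMAdelic (L : Type) (frameD V) × CMAdelic (L : Type) (dW S) →* ℂˣ)
  (hη : ∀ γU ∈ CMRat (L : Type) (frameD V), ∀ γ ∈ CMRat (L : Type) (dW S), η (γU, γ) = 1)
  (hηc : Continuous fun p => ((η p : ℂˣ) : ℂ))
  (τ : L →+* ℂ) (T : GL (Fin 3) ℂ)
  (hT : formCongr (starRingEnd ℂ) T (V.Hm.map τ) = Literature.Geometry.ComplexHyperbolic.BallModel.J)
variable (jD : InfinitePlace (L : Type) → HodgeCM.PerL34.Fock.EqVar → Fin 6) (m₁ m₂ : InfinitePlace (L : Type) → ℤ)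
variable {σ : InfinitePlace (L : Type) → Equiv.Perm (Fin 2)}
variable (hW : (∀ j, 0 < (ι₁ ((dW S) j)).re) ∨ ∀ j, (ι₁ ((dW S) j)).re < 0)

/-- the `ι₁` variable identification family of the pin (the same `jIAt` at every place; `datumAt` uses it only at the place under `ι₁`). -/
def jIOf : InfinitePlace (L : Type) → HodgeCM.PerL34.Fock.PlaneVar → Fin 6 :=
  fun _ => jIAt (L : Type) (frameD V) (frameD_real V) (dW S) (dW_real S) ι₁ (frameD_sign_ι₁ V) hW

/-- the per-place torus scalar of the chosen data: `dIotaAt` at the place under `ι₁`, `1` elsewhere. -/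
def dAt (w : {v : InfinitePlace ↥(maximalRealSubfield L) // v.IsReal}) (u : SeesawArchTorus (L : Type)) : ℂ :=
  if cmPlace (L : Type) ι₁ = w then dIotaAt (L : Type) (frameD V) (dW S) (dW_real S) ι₁ u else 1

/-- (Ported verbatim from the HodgeCMPerL package; no docstring in the source.) -/
theorem prod_dAt (u : SeesawArchTorus (L : Type)) :
    ∏ w, dAt V S w u = dIotaAt (L : Type) (frameD V) (dW S) (dW_real S) ι₁ u := by
  unfold dAt
  rw [Finset.prod_ite_eq, if_pos (Finset.mem_univ _)]

/-- off the place under `ι₁` the chosen datum is not of kind `ι₁`. -/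
theorem datumAt_kind_ne_iota_of_ne (jI : InfinitePlace (L : Type) → HodgeCM.PerL34.Fock.PlaneVar → Fin 6)
    (b : InfinitePlace (L : Type)) (hb : cmPlacesEquiv (L : Type) b ≠ cmPlace (L : Type) ι₁) :
    (datumAtσ V S jD jI σ b).kind ≠ .iota := by
  by_cases hsig : Nonempty (PosIdx (cmXW (L : Type) (frameD V) (dW S) (dW_real S) ι₁ (cmPlacesEquiv (L : Type) b))) ∧
      Nonempty (NegIdx (cmXW (L : Type) (frameD V) (dW S) (dW_real S) ι₁ (cmPlacesEquiv (L : Type) b)))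
  · rcases datumAt_kind_of_sigma V S jD jI b hb hsig with hk | hk <;> rw [hk] <;> exact PlaceKind.noConfusion
  · rw [datumAt_kind_of_delta V S jD jI b hb hsig]; exact PlaceKind.noConfusion

/-- the kind of the chosen datum is `ι₁` exactly at the place under `ι₁`. -/
theorem eq_cmPlace_of_datumAt_kind (jI : InfinitePlace (L : Type) → HodgeCM.PerL34.Fock.PlaneVar → Fin 6)
    (w : {v : InfinitePlace ↥(maximalRealSubfield L) // v.IsReal})
    (hk : (datumAtσ V S jD jI σ ((cmPlacesEquiv (L : Type)).symm w)).kind = .iota) : w = cmPlace (L : Type) ι₁ := by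
  by_contra hw
  exact datumAt_kind_ne_iota_of_ne V S jD jI ((cmPlacesEquiv (L : Type)).symm w)
    (by rw [Equiv.apply_symm_apply]; exact hw) hk

/-- **`omg_ins` AT THE PRINTED VACUUM for the chosen place data, from ONE scalar identity on the torus.** -/
theorem omgW_ins_vacuum_datumAt_eq_of_weight
    (hμ : ∀ t : (printPlaces (InfinitePlace (L : Type))
        (kindOf (L : Type) (frameD V) (frameD_real V) (dW S) (dW_real S) ι₁ (datumAtσ V S jD (jIOf V S hW) σ))
        (lamOf (L : Type) (frameD V) (frameD_real V) (dW S) (dW_real S) ι₁ (datumAtσ V S jD (jIOf V S hW) σ))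
        (lamOf_ne_zero (L : Type) (frameD V) (frameD_real V) (dW S) (dW_real S) ι₁ (datumAtσ V S jD (jIOf V S hW) σ))
        (pinnedVacs (kindOf (L : Type) (frameD V) (frameD_real V) (dW S) (dW_real S) ι₁ (datumAtσ V S jD (jIOf V S hW) σ)) m₁ m₂)).Tg,
      (((η (archProdHom (↥(maximalRealSubfield L)) (L : Type) (IsCMField.complexConj L) 3 2 (Matrix.diagonal (frameD V))
            (Matrix.diagonal (dW S))
            ((1 : UnitaryGroup.arch (↥(maximalRealSubfield L)) (L : Type) (IsCMField.complexConj L) 3 (Matrix.diagonal (frameD V))),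
              archDiag (L : Type) (dW S) (archOf V S (datumAtσ V S jD (jIOf V S hW) σ) m₁ m₂ t))) : ℂˣ) : ℂ) *
          ((pinTorusChar V S hGR hW (archOf V S (datumAtσ V S jD (jIOf V S hW) σ) m₁ m₂ t) : Circle) : ℂ) *
          dIotaAt (L : Type) (frameD V) (dW S) (dW_real S) ι₁ (archOf V S (datumAtσ V S jD (jIOf V S hW) σ) m₁ m₂ t)) =
        (printPlacesW (InfinitePlace (L : Type))
          (kindOf (L : Type) (frameD V) (frameD_real V) (dW S) (dW_real S) ι₁ (datumAtσ V S jD (jIOf V S hW) σ))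
          (lamOf (L : Type) (frameD V) (frameD_real V) (dW S) (dW_real S) ι₁ (datumAtσ V S jD (jIOf V S hW) σ))
          (lamOf_ne_zero (L : Type) (frameD V) (frameD_real V) (dW S) (dW_real S) ι₁ (datumAtσ V S jD (jIOf V S hW) σ))
          (pinnedVacs (kindOf (L : Type) (frameD V) (frameD_real V) (dW S) (dW_real S) ι₁ (datumAtσ V S jD (jIOf V S hW) σ)) m₁ m₂) t)⁻¹)
    (f : FinSB ↥(maximalRealSubfield L) (Fin 6))
    (t : (printPlaces (InfinitePlace (L : Type))
        (kindOf (L : Type) (frameD V) (frameD_real V) (dW S) (dW_real S) ι₁ (datumAtσ V S jD (jIOf V S hW) σ))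
        (lamOf (L : Type) (frameD V) (frameD_real V) (dW S) (dW_real S) ι₁ (datumAtσ V S jD (jIOf V S hW) σ))
        (lamOf_ne_zero (L : Type) (frameD V) (frameD_real V) (dW S) (dW_real S) ι₁ (datumAtσ V S jD (jIOf V S hW) σ))
        (pinnedVacs (kindOf (L : Type) (frameD V) (frameD_real V) (dW S) (dW_real S) ι₁ (datumAtσ V S jD (jIOf V S hW) σ)) m₁ m₂)).Tg)
    (a : ℂ) :
    omgW (wmInputCM₂g V S hGR η hη hηc τ T hT)
        (printedTorusHom (kindOf (L : Type) (frameD V) (frameD_real V) (dW S) (dW_real S) ι₁ (datumAtσ V S jD (jIOf V S hW) σ))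
          (lamOf (L : Type) (frameD V) (frameD_real V) (dW S) (dW_real S) ι₁ (datumAtσ V S jD (jIOf V S hW) σ))
          (lamOf_ne_zero (L : Type) (frameD V) (frameD_real V) (dW S) (dW_real S) ι₁ (datumAtσ V S jD (jIOf V S hW) σ))
          (S.jT₁₂.toMonoidHom.comp (toAdeles (L : Type)))
          (pinnedVacs (kindOf (L : Type) (frameD V) (frameD_real V) (dW S) (dW_real S) ι₁ (datumAtσ V S jD (jIOf V S hW) σ)) m₁ m₂) t)
        (ins (L : Type) (frameD V) (frameD_real V) (frameD_ne V) (dW S) (dW_real S) (dW_ne S) ι₁ (datumAtσ V S jD (jIOf V S hW) σ) m₁ m₂ f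
          (a • (printPlaces (InfinitePlace (L : Type)) _ _ _ _).φ₀)) =
      ins (L : Type) (frameD V) (frameD_real V) (frameD_ne V) (dW S) (dW_real S) (dW_ne S) ι₁ (datumAtσ V S jD (jIOf V S hW) σ) m₁ m₂ f
        ((printPlaces (InfinitePlace (L : Type))
          (kindOf (L : Type) (frameD V) (frameD_real V) (dW S) (dW_real S) ι₁ (datumAtσ V S jD (jIOf V S hW) σ))
          (lamOf (L : Type) (frameD V) (frameD_real V) (dW S) (dW_real S) ι₁ (datumAtσ V S jD (jIOf V S hW) σ))
          (lamOf_ne_zero (L : Type) (frameD V) (frameD_real V) (dW S) (dW_real S) ι₁ (datumAtσ V S jD (jIOf V S hW) σ))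
          (pinnedVacs (kindOf (L : Type) (frameD V) (frameD_real V) (dW S) (dW_real S) ι₁ (datumAtσ V S jD (jIOf V S hW) σ)) m₁ m₂)).ωT t
          (a • (printPlaces (InfinitePlace (L : Type)) _ _ _ _).φ₀)) := by
  refine omgW_ins_smul_vacuum_eq_of_weight V S hGR η hη hηc τ T hT (datumAtσ V S jD (jIOf V S hW) σ) m₁ m₂ hW (dAt V S)
    (fun w u hk => ?_) (fun w u hk => ?_) (fun t => ?_) f t a
  · -- off `ι₁`: the scalar is `1`
    unfold dAt
    rw [if_neg]
    intro h
    exact hk (h ▸ datumAt_kind_of_eq V S jD (jIOf V S hW) _ (by rw [Equiv.apply_symm_apply, h]))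
  · -- at `ι₁`: the chosen identification makes `det z` a letter eigenvector
    obtain rfl := eq_cmPlace_of_datumAt_kind V S jD (jIOf V S hW) w hk
    unfold dAt
    rw [if_pos rfl]
    exact linSubst_torusLetter_placePoly_vacuum_iotaAt (L : Type) (frameD V) (frameD_real V) (dW S) (dW_real S) ι₁
      (frameD_sign_ι₁ V) hW (datumAtσ V S jD (jIOf V S hW) σ) m₁ m₂
      (datumAt_of_eq V S jD (jIOf V S hW) _ (Equiv.apply_symm_apply _ _)) u
  · rw [prod_dAt]
    exact hμ t

end PinChoice

end HodgeCM.Model.HypCensus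

end
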